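import Mathlib
import Summits.ValiantsHypothesis.ValiantsHypothesis.Theorems.FifoMatchingNNLowDegreeCofactorHardCofactorBuysVertices
import Summits.ValiantsHypothesis.ValiantsHypothesis.Theorems.FifoMatchingNNLowDegreeCofactorHardStubCarveInterval
import Summits.ValiantsHypothesis.ValiantsHypothesis.Theorems.FifoMatchingNNLowDegreeCofactorHardSupportGenericExpBound
import Literature.Computability.AlgebraicComplexity.NestFreeMatchingPoly
import HarnessLib

/-!
# Route FifoMatching — crux `NNDivisionHard` (stmt-ValiantsHypothesis-21181): cofactors whose monomials
# touch few vertices (ANY degree)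

`NNDivisionHard`: for every `c` and all large `n`, EVERY nonzero cofactor `h ∈ ℝ≥0[x]` has
`2^((log₂ n + c)^c) < L₊(NN_n · h) + L₊(h)`.  The landed ranges are `deg h ≤ d` (rung 22993, closed) and
`deg h ≲ n / polylog n` (`nnDivisionHard_of_degree_budget`).  The freed-vertices method in fact never looks
at the DEGREE of the cofactor, only at the VERTEX SET of one of its monomials:

* `exists_monomial_freeing` — for every nonzero `h` there is a monomial `d₀` of `h` (the top one for the
  vertex-potential weight) such that freeing the arcs at the vertex set of `d₀` yields a polynomial with
  the support of `NN_n^{V(d₀)}` and no larger monotone complexity than `NN_n · h` — whatever the degree;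
* `nnDivisionHard_of_vertexSupport_budget` — hence the conclusion of `NNDivisionHard` for every nonzero
  `h` all of whose monomials touch at most `s` vertices, under the budget
  `(s + 1)·(((log₂ n + c)^c + log₂ n + 1)^6 + 2) ≤ n` (e.g. arbitrary powers of `≤ n / polylog n` arcs).

It strictly contains the degree-budget range (`#V(d) ≤ 2·deg d`).

RESIDUAL (the open content of 21181, for the planner): cofactors having, at the top of EVERY vertex-
potential order, a monomial SPREAD over `Ω(n / polylog n)` vertices; for those the carved interval is too
short for the thick-queue bound and a different engine is needed (the Hrubeš–Yehudayoff normal form puts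
no a-priori bound on the cofactor).

HONEST FRAMING: a PARTIAL RANGE of the OPEN crux `NNDivisionHard`; the crux is NOT claimed; `NNNotVP` and
VP ≠ VNP are NOT proved; monotone ≠ general (`Literature.Barriers.ValiantsHypothesis.MonotoneGap`).
Definitions: the bookkeeping `vertexSupport`; no named facts.
-/

noncomputable section

-- Sub = Summit single-conjunct layout: the duplicated namespace component is mandated by the tree.
set_option linter.dupNamespace false

namespace Summit.ValiantsHypothesis.ValiantsHypothesis.Theorems.FifoMatching.NNLowDegreeCofactorHard

open MvPolynomial Finset Literature.Computability.AlgebraicComplexity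
open Summit.ValiantsHypothesis.ValiantsHypothesis.Theorems.ZeroOneTransfer.Negative
open scoped NNReal

variable {m : ℕ}

/-! ### The vertex set of a monomial -/

/-- The vertex set of a monomial `d` in the arc variables: all endpoints of its arcs. [folklore] -/
def vertexSupport (d : (Fin m × Fin m) →₀ ℕ) : Finset (Fin m) :=
  d.support.image Prod.fst ∪ d.support.image Prod.snd

/-- A vertex of positive vertex degree is an endpoint of an arc of the monomial. [folklore] -/
theorem mem_vertexSupport_of_vertexDeg_pos {d : (Fin m × Fin m) →₀ ℕ} {v : Fin m}
    (hv : 0 < vertexDeg d v) : v ∈ vertexSupport d := by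
  classical
  unfold vertexDeg at hv
  rw [vertexSupport, Finset.mem_union, Finset.mem_image, Finset.mem_image]
  by_contra hcon
  push Not at hcon
  have h1 : ∑ e ∈ d.support with e.1 = v, d e = 0 :=
    Finset.sum_eq_zero fun e he => absurd (Finset.mem_filter.1 he).2 (hcon.1 e (Finset.mem_filter.1 he).1)
  have h2 : ∑ e ∈ d.support with e.2 = v, d e = 0 :=
    Finset.sum_eq_zero fun e he => absurd (Finset.mem_filter.1 he).2 (hcon.2 e (Finset.mem_filter.1 he).1)
  omega

/-- **The top vertex-potential component of a nonzero `h` lives on the vertex set of ONE monomial of `h`**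
(of any degree): with `B = 2·deg h + 1`, some monomial `d₀` of the top component (hence of `h`) has the
vertex-degree vector shared by all monomials of the top component, and every arc of every such monomial
has both endpoints in `V(d₀)`. [folklore] -/
theorem exists_monomial_topComponent {h : MvPolynomial (Fin m × Fin m) ℝ≥0} (hh : h ≠ 0) :
    ∃ d₀ ∈ h.support,
      ∀ d ∈ (topComponent (vertexWeight (2 * h.totalDegree + 1)) h).support, ∀ e ∈ d.support,
        e.1 ∈ vertexSupport d₀ ∧ e.2 ∈ vertexSupport d₀ := by
  classical
  set B := 2 * h.totalDegree + 1 with hB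
  set hs := topComponent (vertexWeight B) h with hhs
  have hne : hs ≠ 0 := topComponent_ne_zero _ hh
  obtain ⟨d₀, hd₀⟩ := exists_coeff_ne_zero hne
  have hd₀s : d₀ ∈ hs.support := mem_support_iff.mpr hd₀
  refine ⟨d₀, support_topComponent_subset _ h hd₀s, ?_⟩
  intro d hd e he
  have hwd : Finsupp.weight (vertexWeight B) d = weightedTotalDegree (vertexWeight B) h := by
    have := mem_support_iff.mp hd
    rw [hhs, coeff_topComponent] at this
    by_contra hne'
    exact this (if_neg hne')
  have hwd₀ : Finsupp.weight (vertexWeight B) d₀ = weightedTotalDegree (vertexWeight B) h := by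
    have := mem_support_iff.mp hd₀s
    rw [hhs, coeff_topComponent] at this
    by_contra hne'
    exact this (if_neg hne')
  have hlt : ∀ d' ∈ hs.support, ∀ v, vertexDeg d' v < B := by
    intro d' hd' v
    have := le_totalDegree (support_topComponent_subset _ h hd')
    have := vertexDeg_le d' v
    omega
  have heq : vertexDeg d = vertexDeg d₀ :=
    eq_of_sum_mul_pow_eq (vertexDeg d) (vertexDeg d₀) (hlt d hd) (hlt d₀ hd₀s)
      (by rw [← weight_vertexWeight, ← weight_vertexWeight, hwd, hwd₀])
  have hp := vertexDeg_pos_of_mem he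
  rw [heq] at hp
  exact ⟨mem_vertexSupport_of_vertexDeg_pos hp.1, mem_vertexSupport_of_vertexDeg_pos hp.2⟩

/-- **Freeing the vertex set of one monomial.** For every nonzero `h ∈ ℝ≥0[x_(i,j)]` some monomial `d₀`
of `h` has the property that `q := (NN_n · top_w h)[arcs at V(d₀) := 1]` has the support of `NN_n^{V(d₀)}`
and `L₊(q) ≤ L₊(NN_n · h)` — the degree of `h` plays no role. [folklore] -/
theorem exists_monomial_freeing (n : ℕ) (h : MvPolynomial (Fin (2 * n) × Fin (2 * n)) ℝ≥0) (hh : h ≠ 0) :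
    ∃ d₀ ∈ h.support, ∃ q : MvPolynomial (Fin (2 * n) × Fin (2 * n)) ℝ≥0,
      q.support = (MvPolynomial.aeval (fun e : Fin (2 * n) × Fin (2 * n) =>
          if e.1 ∈ vertexSupport d₀ ∨ e.2 ∈ vertexSupport d₀
          then (1 : MvPolynomial (Fin (2 * n) × Fin (2 * n)) ℝ≥0)
          else MvPolynomial.X e) (nestFreeMatchingPoly n ℝ≥0)).support ∧
      complexity q ≤ complexity (nestFreeMatchingPoly n ℝ≥0 * h) := by
  obtain ⟨d₀, hd₀, hR⟩ := exists_monomial_topComponent hh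
  set R := vertexSupport d₀ with hRdef
  set W := vertexWeight (m := 2 * n) (2 * h.totalDegree + 1) with hW
  set hs := topComponent W h with hhs
  have hne : hs ≠ 0 := topComponent_ne_zero _ hh
  have hη : (∑ d ∈ hs.support, coeff d hs) ≠ 0 := sum_coeff_ne_zero hne
  refine ⟨d₀, hd₀, MvPolynomial.aeval (fun e : Fin (2 * n) × Fin (2 * n) =>
      if e.1 ∈ R ∨ e.2 ∈ R then (1 : MvPolynomial (Fin (2 * n) × Fin (2 * n)) ℝ≥0)
      else MvPolynomial.X e) (nestFreeMatchingPoly n ℝ≥0 * hs), ?_, ?_⟩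
  · have hφ : MvPolynomial.aeval (fun e : Fin (2 * n) × Fin (2 * n) =>
        if e.1 ∈ R ∨ e.2 ∈ R then (1 : MvPolynomial (Fin (2 * n) × Fin (2 * n)) ℝ≥0)
        else MvPolynomial.X e) hs = C (∑ d ∈ hs.support, coeff d hs) :=
      aeval_eq_C_sum_coeff _ fun d hd e he => if_pos (Or.inl (hR d hd e he).1)
    rw [map_mul, hφ, support_mul_C_of_ne_zero _ hη]
  · have hfree : ∀ e : Fin (2 * n) × Fin (2 * n), complexity
        (if e.1 ∈ R ∨ e.2 ∈ R then (1 : MvPolynomial (Fin (2 * n) × Fin (2 * n)) ℝ≥0)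
          else MvPolynomial.X e) = 0 := by
      intro e
      by_cases he : e.1 ∈ R ∨ e.2 ∈ R
      · rw [if_pos he, ← C_1]; exact complexity_C_holds _
      · rw [if_neg he]; exact complexity_X_holds _
    calc complexity (MvPolynomial.aeval (fun e : Fin (2 * n) × Fin (2 * n) =>
            if e.1 ∈ R ∨ e.2 ∈ R then (1 : MvPolynomial (Fin (2 * n) × Fin (2 * n)) ℝ≥0)
            else MvPolynomial.X e) (nestFreeMatchingPoly n ℝ≥0 * hs))
        ≤ complexity (nestFreeMatchingPoly n ℝ≥0 * hs) := complexity_aeval_le_of_free _ hfree _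
      _ ≤ complexity (nestFreeMatchingPoly n ℝ≥0 * h) := by
          have := complexity_topComponent_le W (nestFreeMatchingPoly n ℝ≥0 * h)
          rwa [topComponent_mul, topComponent_eq_self_of_isWeightedHomogeneous W
            (isWeightedHomogeneous_nestFreeMatchingPoly n _)] at this

/-- **`NNDivisionHard` for cofactors whose monomials touch few vertices (any degree).**  For every `c`
there is `n₀` such that for all `n ≥ n₀` and every nonzero `h ∈ ℝ≥0[x_(i,j)]` all of whose monomials have
vertex sets of size `≤ s` with `(s + 1)·(((log₂ n + c)^c + log₂ n + 1)^6 + 2) ≤ n` (here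
`s := max_{d ∈ supp h} #V(d)`): `2^((log₂ n + c)^c) < L₊(NN_n · h) + L₊(h)`. [folklore] -/
theorem nnDivisionHard_of_vertexSupport_budget :
    ∀ c : ℕ, ∃ n₀ : ℕ, ∀ n ≥ n₀, ∀ h : MvPolynomial (Fin (2 * n) × Fin (2 * n)) ℝ≥0, h ≠ 0 →
      (h.support.sup (fun d => (vertexSupport d).card) + 1) *
          (((Nat.log 2 n + c) ^ c + Nat.log 2 n + 1) ^ 6 + 2) ≤ n →
        2 ^ ((Nat.log 2 n + c) ^ c) <
          complexity (nestFreeMatchingPoly n ℝ≥0 * h) + complexity h := by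
  intro c
  obtain ⟨n₁, hn₁⟩ := exp_lower_bound_of_support_eq
  refine ⟨2 ^ n₁, fun n hn h hh hbudget => ?_⟩
  obtain ⟨d₀, hd₀, q, hq, hqc⟩ := exists_monomial_freeing n h hh
  obtain ⟨n', hn', g, hg, hgc⟩ := FreedVertices.stub_carveInterval n (vertexSupport d₀) q hq
  set s := h.support.sup (fun d => (vertexSupport d).card) with hs
  set k := Nat.log 2 n with hk
  set A := (k + c) ^ c with hA
  have hRs : (vertexSupport d₀).card + 1 ≤ s + 1 :=
    Nat.add_le_add_right (Finset.le_sup (f := fun d => (vertexSupport d).card) hd₀) 1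
  have hle : n ≤ (s + 1) * (n' + 2) := hn'.trans (Nat.mul_le_mul_right _ hRs)
  have hB : (A + k + 1) ^ 6 ≤ n' := by
    have h1 : (s + 1) * ((A + k + 1) ^ 6 + 2) ≤ (s + 1) * (n' + 2) := hbudget.trans hle
    have := Nat.le_of_mul_le_mul_left h1 (by omega)
    omega
  have hnpos : n ≠ 0 := by
    have : 0 < 2 ^ n₁ := by positivity
    omega
  have hk₁ : n₁ ≤ k := Nat.le_log_of_pow_le (by norm_num) hn
  have hk6 : A + k + 1 ≤ (A + k + 1) ^ 6 := by
    calc A + k + 1 = (A + k + 1) ^ 1 := (pow_one _).symm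
      _ ≤ (A + k + 1) ^ 6 := Nat.pow_le_pow_right (by omega) (by norm_num)
  have hn'1 : n₁ ≤ n' := by omega
  have hA6 : (A + 1) ^ 6 ≤ n' := (Nat.pow_le_pow_left (by omega) 6).trans hB
  have hroot : (((A + 1 : ℕ) : ℝ)) ≤ (n' : ℝ) ^ ((1 : ℝ) / 6) := by
    have hcast : (((A + 1 : ℕ) : ℝ)) ^ 6 ≤ (n' : ℝ) := by exact_mod_cast hA6
    have h := Real.rpow_le_rpow (by positivity) hcast (by norm_num : (0 : ℝ) ≤ 1 / 6)
    have h6 : ((((A + 1 : ℕ) : ℝ)) ^ 6) ^ ((1 : ℝ) / 6) = ((A + 1 : ℕ) : ℝ) := by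
      rw [show ((1 : ℝ) / 6) = ((6 : ℕ) : ℝ)⁻¹ by norm_num]
      exact Real.pow_rpow_inv_natCast (by positivity) (by norm_num)
    rw [h6] at h
    exact h
  have hmain := hn₁ n' hn'1 g hg
  have hfinal : (((2 ^ (A + 1) : ℕ) : ℝ)) ≤ (complexity g : ℝ) := by
    calc (((2 ^ (A + 1) : ℕ) : ℝ)) = (2 : ℝ) ^ (((A + 1 : ℕ) : ℝ)) := by
          rw [Real.rpow_natCast]; push_cast; ring
      _ ≤ (2 : ℝ) ^ ((n' : ℝ) ^ ((1 : ℝ) / 6)) :=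
          Real.rpow_le_rpow_of_exponent_le (by norm_num) hroot
      _ ≤ _ := hmain
  have hfinal' : 2 ^ (A + 1) ≤ complexity g := by exact_mod_cast hfinal
  calc 2 ^ ((Nat.log 2 n + c) ^ c) = 2 ^ A := by rw [hA]
    _ < 2 ^ (A + 1) := Nat.pow_lt_pow_right (by norm_num) (by omega)
    _ ≤ complexity g := hfinal'
    _ ≤ complexity q := hgc
    _ ≤ complexity (nestFreeMatchingPoly n ℝ≥0 * h) := hqc
    _ ≤ complexity (nestFreeMatchingPoly n ℝ≥0 * h) + complexity h := Nat.le_add_right _ _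

end Summit.ValiantsHypothesis.ValiantsHypothesis.Theorems.FifoMatching.NNLowDegreeCofactorHard

end
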